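import Mathlib
import HarnessLib
import Summits.NavierStokesRegularity.NavierStokesRegularity.Theorems.PoloidalWindowDoorPoloidalWindowRigidityLargeScaleEnergyDecayTools

/-!
# Route `PoloidalWindowDoor`, crux `PoloidalWindowRigidity` (K2, stmt-NavierStokesRegularity-19708) — whole-class tool:
# LARGE-SCALE ENERGY DECAY of Type-I slices from the cut-off energy identity, CONDITIONAL on a BMO-type mean-oscillation
# bound for the pressure (the K2 lead's programme K2P1-M11-NOTES §5; hypothesis (F1) kept explicit)

Cell ns-regularity-ideate, seat nsreg-p7 gen 5 (third worker; file landed `--supports stmt-NavierStokesRegularity-19708`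
as a helper; the task «TYPER/PROVER TASK (whole-programme value)» of the K2 lead's STATUS line 2026-08-27T02:10:48Z).

Setting: a classical solution `(u, p)` of the unforced unit-viscosity Navier–Stokes system on an open time set `S`
(this is what `IsTypeIAncientMild.exists_isClassicalNSSolutionOn_Ioo` provides on every window of a profile of the
route's Type-I class), a time interval `[t₁, t₂] ⊆ S` with `t₂ < 0`, the Type-I bound `‖u(s,x)‖ ≤ C/√(−s)` on it, and
the MEAN-OSCILLATION HYPOTHESIS on the pressure over the ball `B̄(0, 2R)`:
`∀ s ∈ [t₁,t₂], ∃ c, ∫_{B̄(0,2R)} |p(s,x) − c| dx ≤ (A/(−s)) · |B̄(0,2R)|` — the shape of (F1) «`p(s) − c(s) = Σℛᵢℛⱼ(uᵢuⱼ)`,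
`‖ℛᵢℛⱼ f‖_BMO ≲ ‖f‖_∞`» (Calderón–Zygmund `L∞ → BMO`, Stein 1993 Ch. IV §4.1; KNSS 2009 §2), which this file does NOT
prove and keeps as an explicit hypothesis (no named fact is introduced here).

(The slice tools — `integral_fderiv_cutoff_apply_eq_zero`, `flux_le`, the two ends and the two time integrals — are
in the companion `…LargeScaleEnergyDecayTools`.)

* `integral_fderiv_cutoff_apply_eq_zero` — `∫ Dφ(x)(w x) dx = 0` for a `C¹` divergence-free slice and the cut-off
  `φ = cutoff R` (so the pressure may be replaced by `p − c` in the flux);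
* `flux_le` — the slice bound (`‖Dφ‖ ≤ C₁/R`, `|Δφ| ≤ C₂/R²`):
  `∫ (Δφ|u|² + Dφ(u)|u|² + 2pDφ(u)) ≤ |B̄_{2R}|·[C₂/R²·M² + (C₁/R)M³ + 2(C₁/R)M·A/(−s)]`, `M = C/√(−s)`;
* `integral_cutoff_norm_sq_le` / `setIntegral_ball_le_integral_cutoff` — the two ends: `∫φ|u(t₁)|² ≤ |B̄_{2R}| C²/(−t₁)`
  and `∫_{B_R}|u(t₂)|² ≤ ∫φ|u(t₂)|²`;
* `intervalIntegral_inv_neg`, `intervalIntegral_inv_neg_sqrt_le` — `∫_{t₁}^{t₂} ds/(−s) = log(t₁/t₂)`,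
  `∫_{t₁}^{t₂} ds/((−s)√(−s)) ≤ 2/√(−t₂)`;
* `energy_ball_le` — **`∫_{B(0,R)} |u(t₂)|² ≤ |B̄(0,2R)|·[C²/(−t₁) + C₂C² log(t₁/t₂)/R² + 2C₁(C³ + 2CA)/(R√(−t₂))]`**;
* `energy_ball_le_parabolic` — the choice `t₁ = t₂R²` (`R ≥ 1`): `∫_{B_R}|u(t₂)|² ≤ |B̄_{2R}|·[C²/(R²(−t₂)) +
  2C₂C² log R/R² + 2C₁(C³+2CA)/(R√(−t₂))]` — since `|B̄_{2R}| = 8|B_R|`, the AVERAGE of `|u(t₂)|²` over `B_R` tends to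
  `0` as `R → ∞` on every slice: the lead's «large-scale energy decay of the Type-I mild class», modulo (F1).

WHAT THIS IS NOT: not a claim about Navier–Stokes regularity and not the BMO bound — an energy estimate CONDITIONAL on an
explicit pressure hypothesis (bears_on LADDER-NS N0; every route whose residue lives in the Type-I mild class).
-/

noncomputable section

-- the summit and its single sub-problem share the name (CONVENTIONS §1), as in every Theorems file
set_option linter.dupNamespace false

namespace Summit.NavierStokesRegularity.NavierStokesRegularity.Theorems.PoloidalWindowDoorPoloidalWindowRigidityLargeScaleEnergyDecay

open MeasureTheory Set Function Filter Topology TopologicalSpace Metric InnerProductSpace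
open scoped RealInnerProductSpace InnerProductSpace Laplacian ContDiff
open Literature.Analysis Literature.Analysis.FluidPDE

variable {S : Set ℝ} {u : ℝ → EuclideanSpace ℝ (Fin 3) → EuclideanSpace ℝ (Fin 3)}
  {p : ℝ → EuclideanSpace ℝ (Fin 3) → ℝ}

open Summit.NavierStokesRegularity.NavierStokesRegularity.Theorems.PoloidalWindowDoorPoloidalWindowRigidityLargeScaleEnergyDecayTools

/-! ### The energy on a ball -/

/-- **LARGE-SCALE ENERGY BOUND (conditional on the pressure mean-oscillation hypothesis).**  Let `(u,p)` be a classical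
solution of the unforced unit-viscosity Navier–Stokes system on an open time set `S ⊇ [t₁, t₂]`, `t₁ ≤ t₂ < 0`, with
`‖u(s,x)‖ ≤ C/√(−s)` on `[t₁,t₂]` (`C ≥ 0`) and, for some `A ≥ 0`, the mean-oscillation bound
`∃ c, ∫_{B̄(0,2R)} |p(s) − c| ≤ (A/(−s))·|B̄(0,2R)|` at every `s ∈ [t₁,t₂]`.  Then, with the cut-off constants
`‖D(cutoff R)‖ ≤ C₁/R`, `|Δ(cutoff R)| ≤ C₂/R²`:
`∫_{B(0,R)} |u(t₂)|² ≤ |B̄(0,2R)|·(C²/(−t₁) + C₂C² log(t₁/t₂)/R² + 2C₁(C³ + 2CA)/(R√(−t₂)))`. -/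
theorem energy_ball_le (h : IsClassicalNSSolutionOn S 1 0 u p) (hS : IsOpen S) {t₁ t₂ : ℝ} (h12 : t₁ ≤ t₂)
    (h2 : t₂ < 0) (hI : Icc t₁ t₂ ⊆ S) {C A R C₁ C₂ : ℝ} (hC0 : 0 ≤ C) (hA0 : 0 ≤ A) (hR : 0 < R)
    (hC : ∀ s ∈ Icc t₁ t₂, ∀ x, ‖u s x‖ ≤ C / Real.sqrt (-s))
    (hosc : ∀ s ∈ Icc t₁ t₂, ∃ c : ℝ, ∫ x in closedBall (0 : EuclideanSpace ℝ (Fin 3)) (2 * R), |p s x - c| ≤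
      A / (-s) * volume.real (closedBall (0 : EuclideanSpace ℝ (Fin 3)) (2 * R)))
    (hC₁ : ∀ x, ‖fderiv ℝ (cutoff (E := EuclideanSpace ℝ (Fin 3)) R) x‖ ≤ C₁ / R)
    (hC₂ : ∀ x, |(Δ (cutoff (E := EuclideanSpace ℝ (Fin 3)) R)) x| ≤ C₂ / R ^ 2) :
    ∫ x in ball (0 : EuclideanSpace ℝ (Fin 3)) R, ‖u t₂ x‖ ^ 2 ≤
      volume.real (closedBall (0 : EuclideanSpace ℝ (Fin 3)) (2 * R)) *
        (C ^ 2 / (-t₁) + C₂ * C ^ 2 * Real.log (t₁ / t₂) / R ^ 2 +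
          2 * C₁ * (C ^ 3 + 2 * C * A) / (R * Real.sqrt (-t₂))) := by
  set V : ℝ := volume.real (closedBall (0 : EuclideanSpace ℝ (Fin 3)) (2 * R)) with hVdef
  have hV0 : 0 ≤ V := measureReal_nonneg
  have hC₁0 : 0 ≤ C₁ / R := (norm_nonneg _).trans (hC₁ 0)
  have hC₂0 : 0 ≤ C₂ / R ^ 2 := (abs_nonneg _).trans (hC₂ 0)
  have hC₁0' : 0 ≤ C₁ := by
    have := mul_nonneg hC₁0 hR.le; rwa [div_mul_cancel₀ _ hR.ne'] at this
  have hC₂0' : 0 ≤ C₂ := by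
    have := mul_nonneg hC₂0 (pow_pos hR 2).le; rwa [div_mul_cancel₀ _ (pow_pos hR 2).ne'] at this
  set φ : EuclideanSpace ℝ (Fin 3) → ℝ := cutoff (E := EuclideanSpace ℝ (Fin 3)) R with hφdef
  have hφs : ContDiff ℝ ∞ φ := contDiff_cutoff (n := ⊤) R
  have hφcs : HasCompactSupport φ := hasCompactSupport_cutoff hR
  -- the integrated identity, dissipation dropped
  have hid := h.local_energy_identity_cutoff hS hφs hφcs h12 hI
  have hdiss : 0 ≤ 2 * (1 : ℝ) * ∫ s in t₁..t₂, ∫ x, frobeniusNormSq (fderiv ℝ (u s) x) * φ x := by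
    refine mul_nonneg (by norm_num) (intervalIntegral.integral_nonneg h12 fun s _ => ?_)
    exact integral_nonneg fun x => mul_nonneg (frobeniusNormSq_nonneg _) (cutoff_nonneg R x)
  -- the slice-wise flux bound and its time integral
  set g : ℝ → ℝ := fun s => V * (C₂ / R ^ 2 * (C / Real.sqrt (-s)) ^ 2 + C₁ / R * (C / Real.sqrt (-s)) ^ 3 +
    2 * (C₁ / R) * (C / Real.sqrt (-s)) * (A / (-s))) with hgdef
  have hneg : ∀ s ∈ Icc t₁ t₂, 0 < -s := fun s hs => by linarith [lt_of_le_of_lt hs.2 h2]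
  have hflux : ∀ s ∈ Icc t₁ t₂, ∫ x, (1 * ((Δ φ) x * ‖u s x‖ ^ 2) + fderiv ℝ φ x (u s x) * ‖u s x‖ ^ 2 +
      2 * (p s x * fderiv ℝ φ x (u s x))) ≤ g s := fun s hs =>
    flux_le h (hI hs) hR (hC s hs) (hosc s hs) hC₁ hC₂
  have hGc := h.continuousOn_integral_flux_cutoff (ν := 1) hφs hφcs
  have hI' : uIcc t₁ t₂ ⊆ Icc t₁ t₂ := by rw [uIcc_of_le h12]
  have hGi : IntervalIntegrable (fun s => ∫ x, (1 * ((Δ φ) x * ‖u s x‖ ^ 2) +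
      fderiv ℝ φ x (u s x) * ‖u s x‖ ^ 2 + 2 * (p s x * fderiv ℝ φ x (u s x)))) volume t₁ t₂ :=
    ((hGc.mono (hI'.trans hI))).intervalIntegrable
  -- `g` rewritten with the two model rates
  have hg_eq : ∀ s ∈ Icc t₁ t₂, g s = V * (C₂ / R ^ 2 * C ^ 2) * (1 / (-s)) +
      V * (C₁ / R * C ^ 3 + 2 * (C₁ / R) * C * A) * (1 / (-s * Real.sqrt (-s))) := by
    intro s hs
    have hs0 := hneg s hs
    have hsq : 0 < Real.sqrt (-s) := Real.sqrt_pos.2 hs0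
    have hss : Real.sqrt (-s) ^ 2 = -s := Real.sq_sqrt hs0.le
    have h3 : Real.sqrt (-s) ^ 3 = (-s) * Real.sqrt (-s) := by rw [pow_succ, hss]
    simp only [hgdef, div_pow, hss, h3]
    field_simp
    ring
  have hgc : ContinuousOn g (uIcc t₁ t₂) := by
    rw [uIcc_of_le h12]
    have h1 : ContinuousOn (fun s : ℝ => 1 / (-s)) (Icc t₁ t₂) :=
      continuousOn_const.div continuousOn_id.neg fun s hs => (hneg s hs).ne'
    have h2 : ContinuousOn (fun s : ℝ => 1 / (-s * Real.sqrt (-s))) (Icc t₁ t₂) :=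
      continuousOn_const.div (continuousOn_id.neg.mul continuousOn_id.neg.sqrt) fun s hs =>
        (mul_pos (hneg s hs) (Real.sqrt_pos.2 (hneg s hs))).ne'
    exact ((continuousOn_const.mul h1).add (continuousOn_const.mul h2)).congr fun s hs => hg_eq s hs
  have hgi : IntervalIntegrable g volume t₁ t₂ := hgc.intervalIntegrable
  have hint_le : ∫ s in t₁..t₂, (∫ x, (1 * ((Δ φ) x * ‖u s x‖ ^ 2) + fderiv ℝ φ x (u s x) * ‖u s x‖ ^ 2 +
      2 * (p s x * fderiv ℝ φ x (u s x)))) ≤ ∫ s in t₁..t₂, g s :=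
    intervalIntegral.integral_mono_on h12 hGi hgi fun s hs => hflux s hs
  -- evaluate `∫ g`
  have hg_int : ∫ s in t₁..t₂, g s ≤ V * (C₂ / R ^ 2 * C ^ 2) * Real.log (t₁ / t₂) +
      V * (C₁ / R * C ^ 3 + 2 * (C₁ / R) * C * A) * (2 / Real.sqrt (-t₂)) := by
    have e : ∫ s in t₁..t₂, g s = ∫ s in t₁..t₂, (V * (C₂ / R ^ 2 * C ^ 2) * (1 / (-s)) +
        V * (C₁ / R * C ^ 3 + 2 * (C₁ / R) * C * A) * (1 / (-s * Real.sqrt (-s)))) :=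
      intervalIntegral.integral_congr fun s hs => hg_eq s (hI' hs)
    have hi1 : IntervalIntegrable (fun s : ℝ => 1 / (-s)) volume t₁ t₂ := by
      refine (ContinuousOn.intervalIntegrable ?_)
      rw [uIcc_of_le h12]
      exact continuousOn_const.div continuousOn_id.neg fun s hs => (hneg s hs).ne'
    have hi2 : IntervalIntegrable (fun s : ℝ => 1 / (-s * Real.sqrt (-s))) volume t₁ t₂ := by
      refine (ContinuousOn.intervalIntegrable ?_)
      rw [uIcc_of_le h12]
      exact continuousOn_const.div (continuousOn_id.neg.mul continuousOn_id.neg.sqrt) fun s hs =>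
        (mul_pos (hneg s hs) (Real.sqrt_pos.2 (hneg s hs))).ne'
    rw [e, intervalIntegral.integral_add (hi1.const_mul _) (hi2.const_mul _), intervalIntegral.integral_const_mul,
      intervalIntegral.integral_const_mul, intervalIntegral_inv_neg h12 h2]
    have hk : 0 ≤ V * (C₁ / R * C ^ 3 + 2 * (C₁ / R) * C * A) := by positivity
    nlinarith [mul_le_mul_of_nonneg_left (intervalIntegral_inv_neg_sqrt_le h12 h2) hk]
  -- the two ends
  have hend₁ : ∫ x, φ x * ‖u t₁ x‖ ^ 2 ≤ V * (C / Real.sqrt (-t₁)) ^ 2 :=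
    integral_cutoff_norm_sq_le (h.contDiff_velocity (hI ⟨le_rfl, h12⟩)).continuous hR
      (hC t₁ ⟨le_rfl, h12⟩)
  have hend₂ : ∫ x in ball (0 : EuclideanSpace ℝ (Fin 3)) R, ‖u t₂ x‖ ^ 2 ≤ ∫ x, φ x * ‖u t₂ x‖ ^ 2 :=
    setIntegral_ball_le_integral_cutoff (h.contDiff_velocity (hI ⟨h12, le_rfl⟩)).continuous hR
  -- assemble
  have ht1 : 0 < -t₁ := by linarith
  have hsq1 : (C / Real.sqrt (-t₁)) ^ 2 = C ^ 2 / (-t₁) := by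
    rw [div_pow, Real.sq_sqrt ht1.le]
  have hsq2 : 0 < Real.sqrt (-t₂) := Real.sqrt_pos.2 (by linarith)
  have hfinal : ∫ x in ball (0 : EuclideanSpace ℝ (Fin 3)) R, ‖u t₂ x‖ ^ 2 ≤
      V * (C ^ 2 / (-t₁)) + (V * (C₂ / R ^ 2 * C ^ 2) * Real.log (t₁ / t₂) +
        V * (C₁ / R * C ^ 3 + 2 * (C₁ / R) * C * A) * (2 / Real.sqrt (-t₂))) := by
    rw [← hsq1]
    linarith [hid, hdiss, hint_le, hg_int, hend₁, hend₂]
  refine hfinal.trans (le_of_eq ?_)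
  field_simp
  ring

/-- **LARGE-SCALE ENERGY DECAY, parabolic choice `t₁ = t₂R²`** (`R ≥ 1`, so `t₂R² ≤ t₂`): under the hypotheses
of `energy_ball_le` on `[t₂R², t₂]`,
`∫_{B(0,R)} |u(t₂)|² ≤ |B̄(0,2R)|·(C²/(R²(−t₂)) + 2C₂C² log R/R² + 2C₁(C³+2CA)/(R√(−t₂)))`;
since `|B̄(0,2R)| = 8|B(0,R)|`, the mean of `|u(t₂)|²` over `B(0,R)` is `O(log R/R²) + O(1/(R√(−t₂)))` — it tends
to `0` as `R → ∞` on every slice (K2 lead, K2P1-M11-NOTES §5, modulo the pressure hypothesis (F1)). -/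
theorem energy_ball_le_parabolic (h : IsClassicalNSSolutionOn S 1 0 u p) (hS : IsOpen S) {t₂ : ℝ} (h2 : t₂ < 0)
    {R : ℝ} (hR : 1 ≤ R) (hI : Icc (t₂ * R ^ 2) t₂ ⊆ S) {C A C₁ C₂ : ℝ} (hC0 : 0 ≤ C) (hA0 : 0 ≤ A)
    (hC : ∀ s ∈ Icc (t₂ * R ^ 2) t₂, ∀ x, ‖u s x‖ ≤ C / Real.sqrt (-s))
    (hosc : ∀ s ∈ Icc (t₂ * R ^ 2) t₂, ∃ c : ℝ,
      ∫ x in closedBall (0 : EuclideanSpace ℝ (Fin 3)) (2 * R), |p s x - c| ≤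
        A / (-s) * volume.real (closedBall (0 : EuclideanSpace ℝ (Fin 3)) (2 * R)))
    (hC₁ : ∀ x, ‖fderiv ℝ (cutoff (E := EuclideanSpace ℝ (Fin 3)) R) x‖ ≤ C₁ / R)
    (hC₂ : ∀ x, |(Δ (cutoff (E := EuclideanSpace ℝ (Fin 3)) R)) x| ≤ C₂ / R ^ 2) :
    ∫ x in ball (0 : EuclideanSpace ℝ (Fin 3)) R, ‖u t₂ x‖ ^ 2 ≤
      volume.real (closedBall (0 : EuclideanSpace ℝ (Fin 3)) (2 * R)) *
        (C ^ 2 / (R ^ 2 * (-t₂)) + 2 * C₂ * C ^ 2 * Real.log R / R ^ 2 +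
          2 * C₁ * (C ^ 3 + 2 * C * A) / (R * Real.sqrt (-t₂))) := by
  have hR0 : 0 < R := lt_of_lt_of_le one_pos hR
  have hR2 : 1 ≤ R ^ 2 := one_le_pow₀ hR
  have h12 : t₂ * R ^ 2 ≤ t₂ := by nlinarith
  have h := energy_ball_le h hS h12 h2 hI hC0 hA0 hR0 hC hosc hC₁ hC₂
  have hlog : Real.log (t₂ * R ^ 2 / t₂) = 2 * Real.log R := by
    rw [mul_div_cancel_left₀ _ h2.ne, Real.log_pow]; norm_num
  have hneg : -(t₂ * R ^ 2) = R ^ 2 * (-t₂) := by ring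
  rw [hlog, hneg] at h
  refine h.trans (le_of_eq ?_)
  ring

end Summit.NavierStokesRegularity.NavierStokesRegularity.Theorems.PoloidalWindowDoorPoloidalWindowRigidityLargeScaleEnergyDecay

end
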